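import Literature.AnabelianGeometry.SemiGraphs.SgATemperedOfFiniteEtale
import Literature.AnabelianGeometry.SemiGraphs.ProfiniteSemiGraphIsoTransportHypotheses
import Literature.AnabelianGeometry.SemiGraphs.CoveringGraphConnected
import HarnessLib

/-!
# [SemiAnbd] Thm. 3.7 / Cor. 3.9: the standing hypotheses DESCEND to finite étale coverings — for the
# cell's ABSTRACT four-clause coverings between connected objects (proof-only corollary of law L1)

Mochizuki, *Semi-graphs of anabelioids*, Publ. RIMS **42** (2006), §3 Prop. 3.6 / Thm. 3.7 / Cor. 3.9
pp. 38–42 (standing hypotheses: connected, countable, quasi-coherent, totally elevated, totally aloof /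
estranged, verticially slim, of injective type), Def. 2.2 (i) p. 23 (finite étale coverings), Def. 3.5
(i)/(ii) p. 37 (kurims `paper:url-f33ace170ff4`); strict coherence [IUTchI] Rmk. 2.5.3 (i) (T3).
[cite: MochizukiSemiAnbd2006, Thm 3.7 p.40]

PROOF-ONLY corollary (abc-iut cell, layer L3; (R1) bridge of the [SemiAnbd] §§4–5 container, seat
abc-iut-L3-t3).  abc-iut-L3-d6's route T / TRANSPORT proved that the class «hypotheses of Thm. 3.7 +
strictly coherent» passes to the covering semi-graph `G_S` of every connected tempered covering `S`
(`thm37Hypotheses_and_isStrictlyCoherent_coveringGraph`) and descends along abc-iut-L3-t3's isomorphisms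
OVER a base (`thm37Hypotheses_of_isoOver_coveringHom`, "the input of abc-iut-L3-t3's tempered
`SgA`-arrows").  With `SgATemperedOfFiniteEtale.nonempty_isoOver_toCovObj` (every four-clause covering
of connected objects, read on profinite presentations, is isomorphic over the base to the covering of the
finite object `toCovObj A`):

* `Hom.isConnectedObj_toCovObj_of_isoOver` — `toCovObj A` is a CONNECTED object of `B^temp(𝒦)` as
  soon as some connected `ℋ` with a vertex reads isomorphic over `𝒦` to its covering
  (abc-iut-L3-t2/d6 `isConnectedObj_of_isConnected_coveringGraph`);
* `Hom.thm37Hypotheses_of_isFiniteEtaleCoveringGlobal` — **for a four-clause finite étale covering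
  `ψ : ℋ → 𝒦` with `ℋ` connected, with a vertex and every edge abutting: if `𝒦.toProfinite` is a
  strictly coherent Thm-3.7 graph of anabelioids, so is `ℋ.toProfinite`**; `…cor39Hypotheses…` — the
  same for the hypotheses of Cor. 3.9;
* `SgA.thm37Hypotheses_of_finiteEtale` / `SgA.cor39Hypotheses_of_finiteEtale` — the same for finite
  étale arrows `f : H → G` of the ambient category `SgA` of §§4–5 between connected objects.

So the Thm. 3.7 / Cor. 3.9 ladder of the cell applies to (the profinite presentation of) every finite
étale covering of a strictly coherent Thm-3.7 graph — e.g. along towers `𝒢″ → 𝒢′ → 𝒢`.  No `def`, no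
new `Prop`; nothing here takes a side on [IUTchIII] Cor. 3.12.
-/

noncomputable section

namespace Literature.AnabelianGeometry.SemiGraphs

open CategoryTheory CategoryTheory.Limits
open Literature.AlgebraicGeometry.Frobenioids (IsConnectedObj)

universe u

namespace SemiGraphOfAnabelioids

namespace Hom

variable {ℋ 𝒦 : SemiGraphOfAnabelioids.{u, u, u}} (ψ : Hom ℋ 𝒦)

/-- **`toCovObj A` is connected in `B^temp(𝒦)`** when a CONNECTED `ℋ` with a vertex reads, on profinite
presentations, isomorphic over `𝒦` to the covering `𝒢_{toCovObj A} → 𝒦`: the covering semi-graph is then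
connected with a vertex (transport along the base isomorphism), and abc-iut-L3-t2/d6's
`isConnectedObj_of_isConnected_coveringGraph` applies. [cite: MochizukiSemiAnbd2006, Def 3.5(ii) p.37] -/
theorem isConnectedObj_toCovObj_of_isoOver (A : 𝒦.BObj)
    (I : ProfiniteSemiGraph.Hom.IsoOver ψ.toProfinite (BObj.toCovObj A).coveringHom)
    (hS : (BObj.toCovObj A).IsTempered) (hℋ : ℋ.IsConnected) (hv : Nonempty ℋ.graph.Vertex) :
    IsConnectedObj (⟨BObj.toCovObj A, hS⟩ : ProfiniteSemiGraph.BTempCat 𝒦.toProfinite) := by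
  haveI := I.isIso_base
  exact (BObj.toCovObj A).isConnectedObj_of_isConnected_coveringGraph hS
    (SemiGraph.isConnected_of_isIso I.iso.base hℋ.isConnected) ⟨I.iso.base.vertexMap (Classical.choice hv)⟩

/-- **Thm. 3.7's hypotheses and strict coherence descend to four-clause finite étale coverings.**  Let
`ψ : ℋ → 𝒦` be a finite étale covering in the cell's four-clause sense (abc-iut-L3-t1's
`Hom.IsFiniteEtaleCoveringGlobal`), `ℋ` connected with a vertex and every edge abutting.  If the
profinite presentation of `𝒦` is a strictly coherent Thm-3.7 graph of anabelioids, then so is that of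
`ℋ` (law L1's isomorphism over the base + abc-iut-L3-d6's transport and route T).
[cite: MochizukiSemiAnbd2006, Thm 3.7 p.40] -/
theorem thm37Hypotheses_of_isFiniteEtaleCoveringGlobal (hψ : ψ.IsFiniteEtaleCoveringGlobal)
    (hℋ : ℋ.IsConnected) (hv : Nonempty ℋ.graph.Vertex) (hab : ℋ.EveryEdgeAbuts)
    (h37 : 𝒦.toProfinite.Thm37Hypotheses) (hsc : 𝒦.toProfinite.IsStrictlyCoherent) :
    ℋ.toProfinite.Thm37Hypotheses ∧ ℋ.toProfinite.IsStrictlyCoherent := by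
  obtain ⟨A, ⟨I⟩⟩ :=
    ψ.exists_isoOver_toCovObj_of_isFiniteEtaleCoveringGlobal hψ hℋ ⟨h37.isConnected⟩ hab
  have hS : (BObj.toCovObj A).IsTempered :=
    ProfiniteSemiGraph.FiniteIsTempered_holds 𝒦.toProfinite h37.isConnected h37.isCountable _
      (BObj.toCovObj_isFinite A)
  exact ProfiniteSemiGraph.thm37Hypotheses_of_isoOver_coveringHom (BObj.toCovObj A) I h37 hsc hS
    (ψ.isConnectedObj_toCovObj_of_isoOver A I hS hℋ hv)

/-- **Cor. 3.9's hypotheses descend to four-clause finite étale coverings** (same setting; abc-iut-L3-d6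
`cor39Hypotheses_coveringGraph` + `Hom.IsoOver.cor39Hypotheses`). [cite: MochizukiSemiAnbd2006, Cor 3.9 p.42] -/
theorem cor39Hypotheses_of_isFiniteEtaleCoveringGlobal (hψ : ψ.IsFiniteEtaleCoveringGlobal)
    (hℋ : ℋ.IsConnected) (hv : Nonempty ℋ.graph.Vertex) (hab : ℋ.EveryEdgeAbuts)
    (h39 : ProfiniteSemiGraph.Cor39Hypotheses 𝒦.toProfinite)
    (hsc : 𝒦.toProfinite.IsStrictlyCoherent) :
    ProfiniteSemiGraph.Cor39Hypotheses ℋ.toProfinite ∧ ℋ.toProfinite.IsStrictlyCoherent := by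
  obtain ⟨A, ⟨I⟩⟩ :=
    ψ.exists_isoOver_toCovObj_of_isFiniteEtaleCoveringGlobal hψ hℋ ⟨h39.isConnected⟩ hab
  have hS : (BObj.toCovObj A).IsTempered :=
    ProfiniteSemiGraph.FiniteIsTempered_holds 𝒦.toProfinite h39.isConnected h39.isCountable _
      (BObj.toCovObj_isFinite A)
  have hSc := ψ.isConnectedObj_toCovObj_of_isoOver A I hS hℋ hv
  have h37 : 𝒦.toProfinite.Thm37Hypotheses := ⟨h39.toProp36Hypotheses, h39.isTotallyEstranged⟩
  exact ⟨I.cor39Hypotheses ((BObj.toCovObj A).cor39Hypotheses_coveringGraph h39 hsc hS hSc)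
      ((BObj.toCovObj A).isStrictlyCoherent_coveringGraph h39.isConnected hsc hS hSc),
    (ProfiniteSemiGraph.thm37Hypotheses_of_isoOver_coveringHom (BObj.toCovObj A) I h37 hsc hS hSc).2⟩

end Hom

end SemiGraphOfAnabelioids

/-! ### The same for finite étale arrows of the ambient category `SgA` -/

namespace SgAQuot.SgA

open SemiGraphOfAnabelioids ProfiniteSemiGraph

variable {H G : SgA.{u, u, u}} (f : H ⟶ G)

/-- **Finite étale arrows of `SgA` between connected objects descend Thm. 3.7's hypotheses and strict
coherence** from the target's profinite presentation to the source's.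
[cite: MochizukiSemiAnbd2006, Thm 3.7 p.40] -/
theorem thm37Hypotheses_of_finiteEtale (h : finiteEtale f.hom.hom) (hH : H.toSgA.graph.IsConnected)
    (hv : Nonempty H.toSgA.graph.Vertex) (h37 : G.toSgA.toProfinite.Thm37Hypotheses)
    (hsc : G.toSgA.toProfinite.IsStrictlyCoherent) :
    H.toSgA.toProfinite.Thm37Hypotheses ∧ H.toSgA.toProfinite.IsStrictlyCoherent := by
  obtain ⟨φ, -, hglob⟩ := h
  exact φ.thm37Hypotheses_of_isFiniteEtaleCoveringGlobal hglob ⟨hH⟩ hv (SgA.everyEdgeAbuts H) h37 hsc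

/-- **Finite étale arrows of `SgA` between connected objects descend Cor. 3.9's hypotheses and strict
coherence.** [cite: MochizukiSemiAnbd2006, Cor 3.9 p.42] -/
theorem cor39Hypotheses_of_finiteEtale (h : finiteEtale f.hom.hom) (hH : H.toSgA.graph.IsConnected)
    (hv : Nonempty H.toSgA.graph.Vertex) (h39 : Cor39Hypotheses G.toSgA.toProfinite)
    (hsc : G.toSgA.toProfinite.IsStrictlyCoherent) :
    Cor39Hypotheses H.toSgA.toProfinite ∧ H.toSgA.toProfinite.IsStrictlyCoherent := by
  obtain ⟨φ, -, hglob⟩ := h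
  exact φ.cor39Hypotheses_of_isFiniteEtaleCoveringGlobal hglob ⟨hH⟩ hv (SgA.everyEdgeAbuts H) h39 hsc

end SgAQuot.SgA

end Literature.AnabelianGeometry.SemiGraphs

end
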